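import Summits.AtomisticToContinuum.Crystallization.Theorems.HullExactificationCascadeRobustBarlowTemplateTransportSteps1
import Summits.AtomisticToContinuum.Crystallization.Theorems.HullExactificationCascadeRobustBarlowTemplateTransportSteps2
import Summits.AtomisticToContinuum.Crystallization.Theorems.HullExactificationCascadeRobustBarlowTemplateTransportSteps3
import Summits.AtomisticToContinuum.Crystallization.Theorems.HullExactificationCascadeRobustBarlowTemplateTransportSteps5
import Summits.AtomisticToContinuum.Crystallization.Theorems.HullExactificationCascadeRobustBarlowTemplateTransportSteps7
import Summits.AtomisticToContinuum.Crystallization.Theorems.HullExactificationCascadeRobustBarlowTemplateTransportAttach1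
import Summits.AtomisticToContinuum.Crystallization.Theorems.HullExactificationCascadeRobustBarlowTemplateTransportComm1
import Summits.AtomisticToContinuum.Crystallization.Theorems.HullExactificationCascadeRobustBarlowTemplateTransportComm2

/-!
# Line `registered` (crux `RobustBarlowTemplate`, stmt-AtomisticToContinuum-12088): in-layer commutation `I ∘ J = J ∘ I` at parity `+1`

Helper lemmas for `develop_transport` (the geometric half of the development): frames
`⟨x, t₁, t₂, U⟩` read in the scale-relative integer charts `IsZChart` of an everywhere-good
configuration, their transports and the coherence of the resulting development `frameAt`.  The
only metric inputs are the chart transfer lemma `develop_transfer` and `bond_nb_iff`; everything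
else is label combinatorics in `ℤ³` (pattern facts `TransportPatterns*` of the sibling crux 9227,
imported verbatim).  All `[folklore]` (HalesDSP2012 §1.3 for the two kissing patterns).

PORT of `PalmUnimodularRigidityShellsToBarlowChartTransportLayerZero.lean` of the closed sibling
crux `ShellsToBarlowChart` (stmt-9227) to the SCALE-RELATIVE shell relation `y ∈ shell S x` of
this crux (in place of the bond window `0 < dist x y ∧ dist x y ≤ 28/25`) and to the
five-argument charts `IsZChart S x P A nbr`; the port rules (conjunct paths,
`bond a b ↦ b ∈ shell S a`, the threaded symmetry hypothesis
`hsy : ∀ x ∈ S, ∀ y ∈ shell S x, x ∈ shell S y` replacing `bond_symm`, `zchart_transfer` /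
`zchart_sqNormInt_eq` replacing `sqNormInt_transfer` / `IsZChart.sqNormInt_eq`, the
`open … hiding …` line) are listed under "Port notes" in `…RobustBarlowTemplateTransportSteps1.lean`
(and its extensions in `…TransportSteps6.lean`, `…TransportAttach1.lean`, `…TransportComm1.lean`,
`…TransportComm2.lean`).

## Port notes (this part: `TransportLayerZero`)
* none beyond those rules: the signature of `Istep_Jstep_comm` (the only declaration of the source
  part, chart-dependent) is parallel to the source with `hsy` inserted right after `hch` (passed on
  to `Istep_spec`, `Jstep_spec`, `Vstep_spec`, `Vstep_Istep_pt`, `Vstep_Jstep_pt`,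
  `transfer_nb_nb`, `transfer_nb_centre`); the bonds inside the proof became shell memberships and
  each `bond_symm h` an appeal `hsy a ha b h` (the membership `a ∈ S` being `hx`, `hMS`, `hy₁S` or
  `(nb_mem hch hy₁S hc₁'P).1`); otherwise the proof is the source proof verbatim (no metric
  constant occurs in this part); `ZFrame.ext'` is the chart-agnostic 9227 one (see our
  `…TransportComm2`);
* imports: our parts 1, 2, 3, 5, 7, `Attach1`, `Comm1`, `Comm2` (as in the source); the
  `open … hiding …` line is the extended one of our `…TransportComm2` (the 9227 `LayerZero` itself
  is not imported, so `Istep_Jstep_comm` needs no hiding);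
* the anchor at the end (explicit-`∀` form, registered sub-goal) is new.
-/

noncomputable section

namespace Summit.AtomisticToContinuum.Crystallization.Theorems.HullExactificationCascadeRobustBarlowTemplate

open Literature.Geometry.DiscreteGeometry Literature.MathematicalPhysics.StatisticalMechanics
open Summit.AtomisticToContinuum.Crystallization.Theorems.PalmUnimodularRigidityShellsToBarlowChart hiding
  IsZChart TransportSystem scales_tied sqNormInt_transfer bond_symm nb_mem zlab_spec zlab_nb bond_nb_iff
  pattern_cases transfer_nb_nb transfer_nb_centre transfer_nb_target sqNormInt_zlab_centre hcp_of_mirror_pair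
  Istep_spec Jstep_spec IinvStep_spec JinvStep_spec capWithAny_of_mem_cap IinvStep_Istep Istep_IinvStep
  JinvStep_Jstep Jstep_JinvStep polar_at_apex onesided_at_apex nb_inj Istep_lower Jstep_lower
  IinvStep_lower JinvStep_lower Vstep_spec polar_at_lower_apex onesided_at_lower_apex VinvStep_spec
  attach_I_even attach_I_odd Vstep_Istep_pt Vstep_Istep_back attach_lower_I_pos attach_lower_I_neg
  attach_J_even attach_J_odd Vstep_Istep_side Vstep_Jstep_pt

variable {S : Set (EuclideanSpace ℝ (Fin 3))} {Pc : (EuclideanSpace ℝ (Fin 3)) → Finset (Fin 3 → ℤ)}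
  {Ac : (EuclideanSpace ℝ (Fin 3)) → ((EuclideanSpace ℝ (Fin 3)) →ₗᵢ[ℝ] (EuclideanSpace ℝ (Fin 3)))}
  {nb : (EuclideanSpace ℝ (Fin 3)) → (Fin 3 → ℤ) → (EuclideanSpace ℝ (Fin 3))}

/-- **In-layer commutation `I (J g) = J (I g)` at the base layer.**  For a valid frame `g` of parity
`+1` in the base regime (all sites FCC, or `x` HCP) whose four in-layer transports are valid, the
two ways around the rhombus `x, Ix, Jx, IJx` give the same frame at `IJx`: the points agree by the
hexagon identity at `Jx`, the directions by the hexagon identities at `IJx`, and the caps because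
the two transported upper references are the `t₁`- and `t₂`-neighbours of the frame `V g`, hence
bonded, hence in one cap. [folklore] -/
theorem Istep_Jstep_comm (hch : ∀ z ∈ S, IsZChart S z (Pc z) (Ac z) (nb z))
    (hsy : ∀ x ∈ S, ∀ y ∈ shell S x, x ∈ shell S y) {x : (EuclideanSpace ℝ (Fin 3))}
    (hx : x ∈ S) {t₁ t₂ : Fin 3 → ℤ} {U : Finset (Fin 3 → ℤ)} (hU : IsFrame (Pc x) t₁ t₂ U)
    (hpar : frameParity t₁ t₂ U = 1) (hA : (∀ z ∈ S, Pc z = fcc3Int) ∨ Pc x = hcpInt)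
    (hI : IsFrame (Pc (nb x t₁)) (Istep Pc nb ⟨x, t₁, t₂, U⟩).t₁ (Istep Pc nb ⟨x, t₁, t₂, U⟩).t₂
      (Istep Pc nb ⟨x, t₁, t₂, U⟩).U)
    (hJ : IsFrame (Pc (nb x t₂)) (Jstep Pc nb ⟨x, t₁, t₂, U⟩).t₁ (Jstep Pc nb ⟨x, t₁, t₂, U⟩).t₂
      (Jstep Pc nb ⟨x, t₁, t₂, U⟩).U)
    (hIi : IsFrame (Pc (nb x (-t₁))) (IinvStep Pc nb ⟨x, t₁, t₂, U⟩).t₁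
      (IinvStep Pc nb ⟨x, t₁, t₂, U⟩).t₂ (IinvStep Pc nb ⟨x, t₁, t₂, U⟩).U)
    (hJi : IsFrame (Pc (nb x (-t₂))) (JinvStep Pc nb ⟨x, t₁, t₂, U⟩).t₁
      (JinvStep Pc nb ⟨x, t₁, t₂, U⟩).t₂ (JinvStep Pc nb ⟨x, t₁, t₂, U⟩).U) :
    Istep Pc nb (Jstep Pc nb ⟨x, t₁, t₂, U⟩) = Jstep Pc nb (Istep Pc nb ⟨x, t₁, t₂, U⟩) := by
  have hPx := pattern_cases hch hx
  obtain ⟨h12, hhex, hUP, -, -⟩ := id hU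
  have ht₁ : t₁ ∈ Pc x := hhex (mem_hexLabels_iff.2 (Or.inl rfl))
  have ht₂ : t₂ ∈ Pc x := hhex (mem_hexLabels_iff.2 (Or.inr (Or.inl rfl)))
  -- regime at `x`
  have hregI : Pc (nb x t₁) = fcc3Int ∨ Pc x = hcpInt ∨
      (-zlab Pc nb (nb x t₁) x ∈ Pc (nb x t₁) ∧ -zlab Pc nb (nb x t₁) (nb x t₂) ∈ Pc (nb x t₁)) := by
    rcases hA with hF | hH
    · exact Or.inl (hF _ (nb_mem hch hx ht₁).1)
    · exact Or.inr (Or.inl hH)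
  have hregJ : Pc (nb x t₂) = fcc3Int ∨ Pc x = hcpInt ∨
      (-zlab Pc nb (nb x t₂) x ∈ Pc (nb x t₂) ∧ -zlab Pc nb (nb x t₂) (nb x t₁) ∈ Pc (nb x t₂)) := by
    rcases hA with hF | hH
    · exact Or.inl (hF _ (nb_mem hch hx ht₂).1)
    · exact Or.inr (Or.inl hH)
  obtain ⟨hy₁S, hbxy₁, hw₁P, hw₁x, hv₁P, hv₁nb, hnw₁, hnv₁, hDwv₁, -, htype₁, hframe₁, hpar₁, -⟩ :=
    Istep_spec hch hsy hx hU hregI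
  obtain ⟨hy₂S, hbxy₂, hw₂P, hw₂x, hv₂P, hv₂nb, hnw₂, hnv₂, hDwv₂, -, htype₂, hframe₂, hpar₂, -⟩ :=
    Jstep_spec hch hsy hx hU hregJ
  obtain ⟨hcU, huS, hbu, hξP, hξx, hframeV, -, -⟩ := Vstep_spec hch hsy hx hU hI hJ hIi hJi
  obtain ⟨hptI, -, -⟩ := Vstep_Istep_pt hch hsy hx hU hI hJ hIi hJi
  obtain ⟨hptJ, -, -⟩ := Vstep_Jstep_pt hch hsy hx hU hI hJ hIi hJi
  have hPy₁ := pattern_cases hch hy₁S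
  have hPy₂ := pattern_cases hch hy₂S
  have hPu := pattern_cases hch huS
  -- frames `I g = ⟨y₁, a₁, b₁, U₁⟩`, `J g = ⟨y₂, a₂, b₂, U₂⟩`, `V g = ⟨u, τ₁, τ₂, UV⟩`
  set a₁ := (Istep Pc nb ⟨x, t₁, t₂, U⟩).t₁ with ha₁
  set b₁ := (Istep Pc nb ⟨x, t₁, t₂, U⟩).t₂ with hb₁
  set U₁ := (Istep Pc nb ⟨x, t₁, t₂, U⟩).U with hU₁_def
  have hIeq : Istep Pc nb ⟨x, t₁, t₂, U⟩ = ⟨nb x t₁, a₁, b₁, U₁⟩ := rfl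
  set a₂ := (Jstep Pc nb ⟨x, t₁, t₂, U⟩).t₁ with ha₂
  set b₂ := (Jstep Pc nb ⟨x, t₁, t₂, U⟩).t₂ with hb₂
  set U₂ := (Jstep Pc nb ⟨x, t₁, t₂, U⟩).U with hU₂_def
  have hJeq : Jstep Pc nb ⟨x, t₁, t₂, U⟩ = ⟨nb x t₂, a₂, b₂, U₂⟩ := rfl
  set c := apexOf t₁ t₂ U with hc_def
  have hVpt : (Vstep Pc nb ⟨x, t₁, t₂, U⟩).pt = nb x c := rfl
  rw [hIeq, hVpt] at hptI
  rw [hJeq, hVpt] at hptJ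
  set u := nb x c with hu_def
  set τ₁ := (Vstep Pc nb ⟨x, t₁, t₂, U⟩).t₁ with hτ₁_def
  set τ₂ := (Vstep Pc nb ⟨x, t₁, t₂, U⟩).t₂ with hτ₂_def
  have hτ₁P : τ₁ ∈ Pc u := hframeV.2.1 (mem_hexLabels_iff.2 (Or.inl rfl))
  have hτ₂P : τ₂ ∈ Pc u := hframeV.2.1 (mem_hexLabels_iff.2 (Or.inr (Or.inl rfl)))
  rw [hIeq, hJeq]
  obtain ⟨h12₁, hhex₁, hUP₁, -, -⟩ := id hframe₁
  obtain ⟨h12₂, hhex₂, hUP₂, -, -⟩ := id hframe₂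
  have ha₁P : a₁ ∈ Pc (nb x t₁) := hhex₁ (mem_hexLabels_iff.2 (Or.inl rfl))
  have hb₁P : b₁ ∈ Pc (nb x t₁) := hhex₁ (mem_hexLabels_iff.2 (Or.inr (Or.inl rfl)))
  have ha₂P : a₂ ∈ Pc (nb x t₂) := hhex₂ (mem_hexLabels_iff.2 (Or.inl rfl))
  have hb₂P : b₂ ∈ Pc (nb x t₂) := hhex₂ (mem_hexLabels_iff.2 (Or.inr (Or.inl rfl)))
  -- the hexagon identities at `y₁`, `y₂`
  have hhexwv₁ : hexLabels (zlab Pc nb (nb x t₁) x) (zlab Pc nb (nb x t₁) (nb x t₂)) ⊆ Pc (nb x t₁) :=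
    hexLabels_subset_of_symm (Pc (nb x t₁)) hPy₁ _ hw₁P _ hv₁P hDwv₁ hnw₁ hnv₁
  have hhexwv₂ : hexLabels (zlab Pc nb (nb x t₂) x) (zlab Pc nb (nb x t₂) (nb x t₁)) ⊆ Pc (nb x t₂) :=
    hexLabels_subset_of_symm (Pc (nb x t₂)) hPy₂ _ hw₂P _ hv₂P hDwv₂ hnw₂ hnv₂
  have hdh₁ := dist_hexagon (Pc (nb x t₁)) hPy₁ _ hw₁P _ hv₁P hDwv₁ hhexwv₁
  have hdh₂ := dist_hexagon (Pc (nb x t₂)) hPy₂ _ hw₂P _ hv₂P hDwv₂ hhexwv₂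
  -- expressions of the components
  have hb₁e : b₁ = zlab Pc nb (nb x t₁) (nb x t₂) - zlab Pc nb (nb x t₁) x := rfl
  have ha₁e : a₁ = -zlab Pc nb (nb x t₁) x := rfl
  have ha₂e : a₂ = zlab Pc nb (nb x t₂) (nb x t₁) - zlab Pc nb (nb x t₂) x := rfl
  have hb₂e : b₂ = -zlab Pc nb (nb x t₂) x := rfl
  -- regimes at `y₁`, `y₂`
  have hregJ' : Pc (nb (nb x t₁) b₁) = fcc3Int ∨ Pc (nb x t₁) = hcpInt ∨
      (-zlab Pc nb (nb (nb x t₁) b₁) (nb x t₁) ∈ Pc (nb (nb x t₁) b₁) ∧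
        -zlab Pc nb (nb (nb x t₁) b₁) (nb (nb x t₁) a₁) ∈ Pc (nb (nb x t₁) b₁)) := by
    rcases hA with hF | hH
    · exact Or.inl (hF _ (nb_mem hch hy₁S hb₁P).1)
    · exact Or.inr (Or.inl (htype₁ hH))
  have hregI' : Pc (nb (nb x t₂) a₂) = fcc3Int ∨ Pc (nb x t₂) = hcpInt ∨
      (-zlab Pc nb (nb (nb x t₂) a₂) (nb x t₂) ∈ Pc (nb (nb x t₂) a₂) ∧
        -zlab Pc nb (nb (nb x t₂) a₂) (nb (nb x t₂) b₂) ∈ Pc (nb (nb x t₂) a₂)) := by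
    rcases hA with hF | hH
    · exact Or.inl (hF _ (nb_mem hch hy₂S ha₂P).1)
    · exact Or.inr (Or.inl (htype₂ hH))
  -- the two second steps
  obtain ⟨hMS, hbyM, hw'P, hw'y, hv'P, hv'nb, -, -, hDw'v', -, -, hframeA, -, c₂', hc₂'U, hc₂'t,
    -, hbu', hμ'U, hUAeq, -⟩ := Jstep_spec hch hsy hy₁S hframe₁ hregJ'
  obtain ⟨hM₂S, hbyM₂, hw''P, hw''y, hv''P, hv''nb, -, -, hDw''v'', -, -, hframeB, -, c₁'', hc₁''U,
    hc₁''t, -, hbu'', hμ''U, hUBeq, -⟩ := Istep_spec hch hsy hy₂S hframe₂ hregI'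
  -- (a₀) the points agree: `M = nb y₁ b₁ = nb y₂ a₂ = M₂`
  have hbMy₂ : nb x t₂ ∈ shell S (nb (nb x t₁) b₁) := by
    have := (bond_nb_iff hch hy₁S hb₁P hv₁P).2 (by
      rw [hb₁e, show zlab Pc nb (nb x t₁) (nb x t₂) - zlab Pc nb (nb x t₁) x -
        zlab Pc nb (nb x t₁) (nb x t₂) = -zlab Pc nb (nb x t₁) x by abel, sqNormInt_neg]
      exact zchart_sqNormInt_eq (hch _ hy₁S) hw₁P)
    rwa [hv₁nb] at this
  have hθ := zlab_spec hch hy₂S hMS (hsy _ hMS _ hbMy₂)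
  have hbxy₁y₂ : nb x t₂ ∈ shell S (nb x t₁) :=
    (bond_nb_iff hch hx ht₁ ht₂).2 h12
  have Dθv : sqNormInt (zlab Pc nb (nb x t₂) (nb (nb x t₁) b₁) - zlab Pc nb (nb x t₂) (nb x t₁)) = 18 := by
    rw [transfer_nb_centre hch hsy hy₁S hy₂S hbxy₁y₂ hb₁P (hsy _ hMS _ hbMy₂)]
    exact zchart_sqNormInt_eq (hch _ hy₁S) hb₁P
  have Dθw : sqNormInt (zlab Pc nb (nb x t₂) (nb (nb x t₁) b₁) - zlab Pc nb (nb x t₂) x) = 54 := by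
    have hbx : nb (nb x t₁) (zlab Pc nb (nb x t₁) x) ∈ shell S (nb x t₂) := by
      rw [hw₁x]; exact hsy _ hx _ hbxy₂
    have htr := transfer_nb_nb hch hsy hy₁S hy₂S hbxy₁y₂ hb₁P hw₁P (hsy _ hMS _ hbMy₂) hbx
    rw [hw₁x] at htr
    rw [htr, hb₁e, show zlab Pc nb (nb x t₁) (nb x t₂) - zlab Pc nb (nb x t₁) x -
      zlab Pc nb (nb x t₁) x = -(2 • zlab Pc nb (nb x t₁) x - zlab Pc nb (nb x t₁) (nb x t₂)) by
        rw [two_smul]; abel, sqNormInt_neg]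
    exact hdh₁.2.2.2.1
  have hθeq : zlab Pc nb (nb x t₂) (nb (nb x t₁) b₁) = a₂ := by
    rw [ha₂e]
    exact label_third_vertex (Pc (nb x t₂)) hPy₂ _ hw₂P _ hv₂P _ hθ.1 hDwv₂ Dθv Dθw
      (by rw [← ha₂e]; exact ha₂P)
  have hMeq : nb (nb x t₂) a₂ = nb (nb x t₁) b₁ := by rw [← hθeq]; exact hθ.2
  rw [hMeq] at hw''P hw''y hv''P hv''nb hframeB hbu'' hUBeq hM₂S hbyM₂ hDw''v'' hμ''U
  set M := nb (nb x t₁) b₁ with hM_def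
  have hPM := pattern_cases hch hMS
  -- (b₀) the labels at `M`: `α` of `y₁`, `β` of `y₂`, `γ` of `IIx`, `δ` of `JJx`
  set α := zlab Pc nb M (nb x t₁) with hα_def
  set β := zlab Pc nb M (nb x t₂) with hβ_def
  set γ := zlab Pc nb M (nb (nb x t₁) a₁) with hγ_def
  set δ := zlab Pc nb M (nb (nb x t₂) b₂) with hδ_def
  obtain ⟨h12A, hhexA, -, hoffA, -⟩ := id hframeA
  obtain ⟨h12B, hhexB, -, hoffB, -⟩ := id hframeB
  have hnα : -α ∈ Pc M := hhexA (mem_hexLabels_iff.2 (Or.inr (Or.inl rfl)))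
  have hnβ : -β ∈ Pc M := by
    have h := hhexB (mem_hexLabels_iff.2 (Or.inl rfl))
    change -zlab Pc nb (nb (nb x t₂) a₂) (nb x t₂) ∈ Pc M at h
    rwa [hMeq] at h
  have Dαβ : sqNormInt (α - β) = 18 := by
    have h := (bond_nb_iff hch hMS hw'P hw''P).1 (by rw [hw'y, hw''y]; exact hbxy₁y₂)
    exact h
  have hαβ : α - β ∈ Pc M :=
    sub_mem_of_onesided (Pc M) hPM β hw''P α hw'P (by rw [sqNormInt_sub_comm]; exact Dαβ)
      (Or.inl ⟨hnβ, hnα⟩)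
  have hβα : β - α ∈ Pc M :=
    sub_mem_of_onesided (Pc M) hPM α hw'P β hw''P Dαβ (Or.inl ⟨hnα, hnβ⟩)
  -- `γ = α − β`
  have hbMII : nb (nb x t₁) a₁ ∈ shell S M := by
    rw [← hv'nb]; exact (nb_mem hch hMS hv'P).2
  have Dγβ : sqNormInt (γ - β) = 54 := by
    have hbMy₂' : nb (nb x t₁) (zlab Pc nb (nb x t₁) (nb x t₂)) ∈ shell S M := by
      rw [hv₁nb]; exact hbMy₂
    have htr := transfer_nb_nb hch hsy hy₁S hMS hbyM ha₁P hv₁P hbMII hbMy₂'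
    rw [hv₁nb] at htr
    rw [hγ_def, hβ_def, htr, ha₁e, show -zlab Pc nb (nb x t₁) x - zlab Pc nb (nb x t₁) (nb x t₂) =
      -(zlab Pc nb (nb x t₁) x + zlab Pc nb (nb x t₁) (nb x t₂)) by abel, sqNormInt_neg]
    exact hdh₁.2.2.1
  have hγeq : γ = α - β :=
    label_third_vertex (Pc M) hPM β hw''P α hw'P γ hv'P (by rw [sqNormInt_sub_comm]; exact Dαβ)
      (by rw [sqNormInt_sub_comm]; exact hDw'v') Dγβ hαβ
  -- `δ = β − α`
  have hbMJJ : nb (nb x t₂) b₂ ∈ shell S M := by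
    rw [← hv''nb]; exact (nb_mem hch hMS hv''P).2
  have Dδα : sqNormInt (δ - α) = 54 := by
    have hbMy₁' : nb (nb x t₂) (zlab Pc nb (nb x t₂) (nb x t₁)) ∈ shell S M := by
      rw [hv₂nb]; exact hsy _ hy₁S _ hbyM
    have htr := transfer_nb_nb hch hsy hy₂S hMS hbyM₂ hb₂P hv₂P hbMJJ hbMy₁'
    rw [hv₂nb] at htr
    rw [hδ_def, hα_def, htr, hb₂e, show -zlab Pc nb (nb x t₂) x - zlab Pc nb (nb x t₂) (nb x t₁) =
      -(zlab Pc nb (nb x t₂) x + zlab Pc nb (nb x t₂) (nb x t₁)) by abel, sqNormInt_neg]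
    exact hdh₂.2.2.1
  have hδeq : δ = β - α :=
    label_third_vertex (Pc M) hPM α hw'P β hw''P δ hv''P Dαβ
      (by rw [sqNormInt_sub_comm]; exact hDw''v'') Dδα hβα
  -- the direction components agree
  have e₁ : (Istep Pc nb ⟨nb x t₂, a₂, b₂, U₂⟩).t₁ = (Jstep Pc nb ⟨nb x t₁, a₁, b₁, U₁⟩).t₁ := by
    show -zlab Pc nb (nb (nb x t₂) a₂) (nb x t₂) = γ - α
    rw [hMeq, hγeq]; abel
  have e₂ : (Istep Pc nb ⟨nb x t₂, a₂, b₂, U₂⟩).t₂ = (Jstep Pc nb ⟨nb x t₁, a₁, b₁, U₁⟩).t₂ := by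
    show zlab Pc nb (nb (nb x t₂) a₂) (nb (nb x t₂) b₂) - zlab Pc nb (nb (nb x t₂) a₂) (nb x t₂) = -α
    rw [hMeq]
    show δ - β = -α
    rw [hδeq]; abel
  have ept : (Istep Pc nb ⟨nb x t₂, a₂, b₂, U₂⟩).pt = (Jstep Pc nb ⟨nb x t₁, a₁, b₁, U₁⟩).pt := hMeq
  -- (c₀) the caps: the two transported upper references are the `τ₁`- and `τ₂`-neighbours of `V g`
  have hpar₁' : frameParity a₁ b₁ U₁ = 1 := hpar₁.trans hpar
  have hpar₂' : frameParity a₂ b₂ U₂ = 1 := hpar₂.trans hpar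
  obtain ⟨hc₁'U, hc₁'P, hc₁'off, hc₁1, hc₁2, hE₁⟩ := even_form_of_parity hPy₁ hframe₁ hpar₁'
  obtain ⟨hc₂''U, hc₂''P, hc₂''off, hc₂1, hc₂2, hE₂⟩ := even_form_of_parity hPy₂ hframe₂ hpar₂'
  set c₁' := apexOf a₁ b₁ U₁ with hc₁'_def
  set c₂'' := apexOf a₂ b₂ U₂ with hc₂''_def
  have hc₂' : c₂' = c₁' := by
    obtain ⟨-, -, -, -, -, -, -, -, -, -, -, -, -, c₃, -, -, hfilt₃, -, -, -, -⟩ :=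
      Jstep_spec hch hsy hy₁S hframe₁ hregJ'
    have h1 := (filter_evenCap (Pc (nb x t₁)) hPy₁ a₁ ha₁P b₁ hb₁P c₁' hc₁'P h12₁ hhex₁ hc₁'off hc₁1 hc₁2).2.1
    rw [← hE₁, hfilt₃] at h1
    have hmem : c₂' ∈ U₁.filter (fun e => sqNormInt (e - b₁) = 18) := Finset.mem_filter.2 ⟨hc₂'U, hc₂'t⟩
    rw [hfilt₃, Finset.mem_singleton] at hmem
    rw [hmem]; exact Finset.singleton_injective h1
  have hc₁'' : c₁'' = c₂'' := by
    obtain ⟨-, -, -, -, -, -, -, -, -, -, -, -, -, c₃, -, -, hfilt₃, -, -, -, -⟩ :=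
      Istep_spec hch hsy hy₂S hframe₂ hregI'
    have h1 := (filter_evenCap (Pc (nb x t₂)) hPy₂ a₂ ha₂P b₂ hb₂P c₂'' hc₂''P h12₂ hhex₂ hc₂''off hc₂1 hc₂2).1
    rw [← hE₂, hfilt₃] at h1
    have hmem : c₁'' ∈ U₂.filter (fun e => sqNormInt (e - a₂) = 18) := Finset.mem_filter.2 ⟨hc₁''U, hc₁''t⟩
    rw [hfilt₃, Finset.mem_singleton] at hmem
    rw [hmem]; exact Finset.singleton_injective h1
  rw [hc₂'] at hbu' hμ'U hUAeq
  rw [hc₁''] at hbu'' hμ''U hUBeq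
  -- the two reference sites are `nb u τ₁` and `nb u τ₂`
  have hp' : nb (nb x t₁) c₁' = nb u τ₁ := hptI
  have hp : nb (nb x t₂) c₂'' = nb u τ₂ := hptJ
  have hbpp : nb (nb x t₂) c₂'' ∈ shell S (nb (nb x t₁) c₁') := by
    rw [hp', hp]; exact (bond_nb_iff hch huS hτ₁P hτ₂P).2 hframeV.1
  have hμ' := zlab_spec hch hMS (nb_mem hch hy₁S hc₁'P).1 hbu'
  have hμ'' := zlab_spec hch hMS (nb_mem hch hy₂S hc₂''P).1 hbu''
  have Dμμ : sqNormInt (zlab Pc nb M (nb (nb x t₂) c₂'') - zlab Pc nb M (nb (nb x t₁) c₁')) = 18 := by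
    refine (bond_nb_iff hch hMS hμ''.1 hμ'.1).1 ?_
    rw [hμ'.2, hμ''.2]; exact hsy _ (nb_mem hch hy₁S hc₁'P).1 _ hbpp
  have hμ''off : zlab Pc nb M (nb (nb x t₂) c₂'') ∉ hexLabels (Jstep Pc nb ⟨nb x t₁, a₁, b₁, U₁⟩).t₁
      (Jstep Pc nb ⟨nb x t₁, a₁, b₁, U₁⟩).t₂ := by
    rw [← e₁, ← e₂]; exact hoffB _ hμ''U
  have hμ''UA : zlab Pc nb M (nb (nb x t₂) c₂'') ∈ (Jstep Pc nb ⟨nb x t₁, a₁, b₁, U₁⟩).U := by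
    rw [hUAeq]
    simp only [capWithAny, Finset.mem_filter, Finset.mem_singleton]
    exact ⟨hμ''.1, hμ''off, _, rfl, Or.inr Dμμ⟩
  have hU : (Istep Pc nb ⟨nb x t₂, a₂, b₂, U₂⟩).U = (Jstep Pc nb ⟨nb x t₁, a₁, b₁, U₁⟩).U := by
    rw [hUBeq, e₁, e₂]
    exact capWithAny_of_mem_cap hch hMS hframeA hμ''UA
  exact ZFrame.ext' ept e₁ e₂ hU

/-! ## Anchor -/

/-- Anchor (registered sub-goal of stmt-AtomisticToContinuum-12088, toward `develop_transport`):
in-layer commutation `I (J g) = J (I g)` for a valid frame of parity `+1` in the base regime whose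
four in-layer transports are valid (explicit form of `Istep_Jstep_comm`). [folklore] -/
theorem transportLayerZero_anchor : ∀ (S : Set (EuclideanSpace ℝ (Fin 3))) (Pc : EuclideanSpace ℝ (Fin 3) → Finset (Fin 3 → ℤ)) (Ac : EuclideanSpace ℝ (Fin 3) → (EuclideanSpace ℝ (Fin 3) →ₗᵢ[ℝ] EuclideanSpace ℝ (Fin 3))) (nb : EuclideanSpace ℝ (Fin 3) → (Fin 3 → ℤ) → EuclideanSpace ℝ (Fin 3)), (∀ z ∈ S, IsZChart S z (Pc z) (Ac z) (nb z)) → (∀ x ∈ S, ∀ y ∈ shell S x, x ∈ shell S y) → ∀ x ∈ S, ∀ (t₁ t₂ : Fin 3 → ℤ) (U : Finset (Fin 3 → ℤ)), IsFrame (Pc x) t₁ t₂ U → frameParity t₁ t₂ U = 1 → ((∀ z ∈ S, Pc z = fcc3Int) ∨ Pc x = hcpInt) → IsFrame (Pc (nb x t₁)) (Istep Pc nb ⟨x, t₁, t₂, U⟩).t₁ (Istep Pc nb ⟨x, t₁, t₂, U⟩).t₂ (Istep Pc nb ⟨x, t₁, t₂, U⟩).U → IsFrame (Pc (nb x t₂))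 (Jstep Pc nb ⟨x, t₁, t₂, U⟩).t₁ (Jstep Pc nb ⟨x, t₁, t₂, U⟩).t₂ (Jstep Pc nb ⟨x, t₁, t₂, U⟩).U → IsFrame (Pc (nb x (-t₁))) (IinvStep Pc nb ⟨x, t₁, t₂, U⟩).t₁ (IinvStep Pc nb ⟨x, t₁, t₂, U⟩).t₂ (IinvStep Pc nb ⟨x, t₁, t₂, U⟩).U → IsFrame (Pc (nb x (-t₂))) (JinvStep Pc nb ⟨x, t₁, t₂, U⟩).t₁ (JinvStep Pc nb ⟨x, t₁, t₂, U⟩).t₂ (JinvStep Pc nb ⟨x, t₁, t₂, U⟩).U → Istep Pc nb (Jstep Pc nb ⟨x, t₁, t₂, U⟩) = Jstep Pc nb (Istep Pc nb ⟨x, t₁, t₂, U⟩) :=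
  fun _ _ _ _ hch hsy _ hx _ _ _ hU hpar hA hI hJ hIi hJi =>
    Istep_Jstep_comm hch hsy hx hU hpar hA hI hJ hIi hJi

end Summit.AtomisticToContinuum.Crystallization.Theorems.HullExactificationCascadeRobustBarlowTemplate

end
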